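import Summits.RiemannHypothesis.RiemannHypothesis.Theorems.TiltedLandingLaw421R3FarStep

/-!
# BurgersRate — B7 add-on «CHARGED ⟹ ADIABATIC» (lens-2 `rh33346-lens-2-g0`, v1→v2; crux ⟨33346⟩ `TiltedLandingLaw421R`, RATE law F1 = `RhW08.SealSwapQ.FarEnergyLawCQ (4/5)`)

Self-contained algebra over the tree's far-step kit (`RhW08.IsolatedTilt.pairQ`, `RhW08.FarStep.drop_formula`); no decl of the landed
`RhW08.BurgersRate` helper is restated (this file only ADDS `pushdown_im_le_drop`, `charged_im_le`, `realSources_grad_le`, `ChargedAdiabatic`).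
Reading: at a charged far level the pair descends by `< s/4`; the foreign field pushes DOWN (`farPairsPushDown_holds` in the helper), and the drop
formula then says the imaginary part of the far field is PAID FOR BY THE DROP; for real foreign zeros the GRADIENT is bounded by the imaginary part.
Hence the Riccati/Burgers expansion parameter `ε = ‖K′(w)‖/‖K(w)‖² ≤ s(b+y)/(8y²)` exactly where F1 is asserted. Models ≠ Ξ; RH is not proved.
-/

namespace RhW08.BurgersRate

open RhW08.IsolatedTilt RhW08.FarStep
open scoped ComplexConjugate

/-! ## B7: the push-down charge bound and the real-source gradient bound

At a charged far level the tracked pair descends by `< s/4`; by B3 the foreign field pushes DOWN (`Im K(w) ≤ 0`), and the tree's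
`drop_formula` then says the imaginary part is PAID FOR BY THE DROP (B7a). For real foreign zeros the GRADIENT of the far field is in turn
bounded by the imaginary part (B7b). Together: `ε := ‖K′(w)‖/‖K(w)‖² ≤ (b² − Im w²)/(2·Im w²) < s·(b + Im w)/(8·Im w²)` on every charged far
level with real foreign zeros — the expansion parameter of the Burgers/Riccati step is automatically small exactly where F1 is asserted. -/

/-- **B7a (PROVED)** push-down charge bound: `q(w)·K = −2(w − a)`, `0 < Im w`, `Im K ≤ 0` ⇒ `2·Im w·|Im K| ≤ (b² − Im w²)·|K|²`. -/
theorem pushdown_im_le_drop {w K : ℂ} {a b : ℝ} (h : pairQ a b w * K = -(2 * (w - a))) (hy : 0 < w.im)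
    (hlam : K.im ≤ 0) : -(2 * w.im * K.im) ≤ (b ^ 2 - w.im ^ 2) * Complex.normSq K := by
  have hd := drop_formula h
  have hN0 : 0 ≤ Complex.normSq K := Complex.normSq_nonneg K
  have hkey : (w.im * Complex.normSq K - K.im) ^ 2 * ((b ^ 2 - w.im ^ 2) * Complex.normSq K + 2 * w.im * K.im)
      = w.im * K.re ^ 2 * (w.im * Complex.normSq K - 2 * K.im) := by
    linear_combination hd
  have hrhs : 0 ≤ w.im * K.re ^ 2 * (w.im * Complex.normSq K - 2 * K.im) := by
    apply mul_nonneg (mul_nonneg hy.le (sq_nonneg _))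
    nlinarith
  by_cases hK : K = 0
  · subst hK; simp
  · have hNpos : 0 < Complex.normSq K := Complex.normSq_pos.mpr hK
    have hbase : 0 < w.im * Complex.normSq K - K.im := by nlinarith
    have hSpos : 0 < (w.im * Complex.normSq K - K.im) ^ 2 := pow_pos hbase 2
    by_contra hneg
    push Not at hneg
    have hlt : (w.im * Complex.normSq K - K.im) ^ 2 * ((b ^ 2 - w.im ^ 2) * Complex.normSq K + 2 * w.im * K.im) < 0 :=
      mul_neg_of_pos_of_neg hSpos (by linarith)
    linarith

/-- **B7a′ (PROVED)** the charged form: if moreover the descent is `< s/4` (`b − Im w < s/4`, `0 ≤ b`) then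
`2·Im w·|Im K| ≤ (s/4)·(b + Im w)·|K|²`, i.e. `|Im K| ≤ |K|²·s·(b + Im w)/(8·Im w)`. -/
theorem charged_im_le {w K : ℂ} {a b s : ℝ} (h : pairQ a b w * K = -(2 * (w - a))) (hy : 0 < w.im)
    (hlam : K.im ≤ 0) (hb : 0 ≤ b) (hchg : b - w.im < s / 4) :
    -(2 * w.im * K.im) ≤ s / 4 * (b + w.im) * Complex.normSq K := by
  have h1 := pushdown_im_le_drop h hy hlam
  have hN0 : 0 ≤ Complex.normSq K := Complex.normSq_nonneg K
  have h2 : (b ^ 2 - w.im ^ 2) * Complex.normSq K ≤ s / 4 * (b + w.im) * Complex.normSq K := by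
    have : b ^ 2 - w.im ^ 2 = (b - w.im) * (b + w.im) := by ring
    rw [this]
    apply mul_le_mul_of_nonneg_right _ hN0
    exact mul_le_mul_of_nonneg_right hchg.le (by linarith)
  linarith

/-- **B7b (PROVED)** real-source gradient bound: for real sources `u ∈ U` with weights `m u ≥ 0` and `0 < Im w`,
`‖Σ m u/(w − u)²‖ ≤ −Im(Σ m u/(w − u))/Im w` (termwise equality: `|1/(w−u)²| = 1/|w−u|² = −Im(1/(w−u))/Im w`). -/
theorem realSources_grad_le (U : Finset ℝ) (m : ℝ → ℝ) (hm : ∀ u ∈ U, 0 ≤ m u) {w : ℂ} (hw : 0 < w.im) :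
    ‖∑ u ∈ U, (m u : ℂ) / ((w - u) ^ 2)‖ ≤ -(∑ u ∈ U, (m u : ℂ) / (w - u)).im / w.im := by
  have hterm : ∀ u ∈ U, ‖(m u : ℂ) / ((w - u) ^ 2)‖ = -((m u : ℂ) / (w - u)).im / w.im := by
    intro u hu
    have hns : Complex.normSq (w - u) ≠ 0 := by
      intro h0
      have h0' : w - (u : ℂ) = 0 := Complex.normSq_eq_zero.mp h0
      have := congrArg Complex.im h0'
      simp at this
      exact hw.ne' this
    have hnorm : ‖(m u : ℂ) / ((w - u) ^ 2)‖ = m u / Complex.normSq (w - u) := by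
      rw [norm_div, norm_pow, Complex.norm_real, Real.norm_eq_abs, abs_of_nonneg (hm u hu), Complex.sq_norm]
    have him : ((m u : ℂ) / (w - u)).im = -(m u * w.im) / Complex.normSq (w - u) := by
      rw [Complex.div_im]
      simp only [Complex.ofReal_re, Complex.ofReal_im, Complex.sub_im, Complex.sub_re, zero_mul, zero_div,
        zero_sub, sub_zero]
      ring
    rw [hnorm, him]
    field_simp
  calc ‖∑ u ∈ U, (m u : ℂ) / ((w - u) ^ 2)‖ ≤ ∑ u ∈ U, ‖(m u : ℂ) / ((w - u) ^ 2)‖ := norm_sum_le _ _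
    _ = ∑ u ∈ U, -((m u : ℂ) / (w - u)).im / w.im := Finset.sum_congr rfl hterm
    _ = -(∑ u ∈ U, (m u : ℂ) / (w - u)).im / w.im := by
        rw [Complex.im_sum, ← Finset.sum_neg_distrib, Finset.sum_div]

/-- **B7 (typed consequence, words)**: at a charged far level whose foreign zeros are real, with `K(w) = c + Σ m u/(w − u)` (`c` real) the
expansion parameter obeys `‖K′(w)‖ ≤ |Im K(w)|/Im w ≤ ‖K(w)‖²·s·(b + Im w)/(8·Im w²)` — i.e. `ε = ‖K′‖/‖K‖² ≤ s(b + y)/(8y²) < s/(3y)` for `y > 3b/5`.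
`ChargedAdiabatic` records the target inequality in the frame language (the chain B3 → B7a′ → B7b is the proof plan; typed, not yet assembled). -/
def ChargedAdiabatic : Prop :=
  ∀ (w : ℂ) (a b s c : ℝ) (U : Finset ℝ) (m : ℝ → ℝ),
    (∀ u ∈ U, 0 ≤ m u) → (∀ u ∈ U, b ≤ |w.re - u|) → 0 < w.im → 0 ≤ b → w.im ≤ b → b - w.im < s / 4 →
    pairQ a b w * ((c : ℂ) + ∑ u ∈ U, (m u : ℂ) / (w - u)) = -(2 * (w - a)) →
    2 * w.im ^ 2 * ‖∑ u ∈ U, (m u : ℂ) / ((w - u) ^ 2)‖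
      ≤ s / 4 * (b + w.im) * Complex.normSq ((c : ℂ) + ∑ u ∈ U, (m u : ℂ) / (w - u))

end RhW08.BurgersRate
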